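import Literature.NumberTheory.Automorphic.AdditiveCharacterDuality          -- ★ `AddCharDuality.exists_apply_eq_apply_mul_of_maximalIdeal` (finite step: residue-field duality), `restrictInteger`; local field setting
import Summits.HodgeConjecture.HodgeConjecture.Theorems.K2E3CongruenceLayersGL   -- ★ p855410 (this seat): layers `K_m = 1 + ϖ^m M_n(𝒪)`, `mul_inv_mul_mem_congruenceGL_pow_two_mul`; brings ★ `congruenceGL`, `IsUniformizingElement`
import HarnessLib

/-!
# Crux `H413` — K2-LIT E3 «EllipticInputs», U12-h engine (S): EVERY CHARACTER OF A CONGRUENCE LAYER `K_{N'} ⧸ K_N` (`N' ≤ N ≤ 2N'`) OF `GL_n(F)` IS `k ↦ ψ(tr(X(k − 1)))`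
# for some `X ∈ ϖ^{−N}M_n(𝒪)` — surjectivity of the parametrisation of ★ (H-char); rank one = additive duality `(𝒪 ⧸ ϖ^e)^∧ ≅ ϖ^{−e}𝒪 ⧸ 𝒪` by induction on `e` from the
# residue-field step

Cell `hodgecm-mathlib`, Track B «K2-LIT», crux item `stmt-HodgeConjecture-24833` (h413), line `K2_E3_EllipticInputs`, unit U12 «HC characters», socket U12-h
`sig_K2E3CharLocConstNearRegular` (‹#9L›): brick (S) of the «DEPTH HALVING» road (memo `K2/K2E1b-p08/g2/MEMO-H2-depth-halving.v1.K2E1b-p08-g2.md`, seat K2E1b-p08 (g2),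
2026-09-03T23:18Z, for the 9L line lead K2E3-p09 (g2) under K2E3-plan (g1)); `--supports stmt-HodgeConjecture-24833 --as helper`.  THEOREMS ONLY — no `def` (the layer character
`Y ↦ χ(1 + ϖ^{N'}Y)` and its coordinate restrictions are built INSIDE the proofs as anonymous `AddChar` terms), no named fact, no instance, no notation, no `sorry`.
SETTING: `F` a NON-ARCHIMEDEAN LOCAL FIELD (Mathlib `IsNonarchimedeanLocalField`: the residue field is finite — the one place the counting of ★ `AddCharDuality`'s finite step is
used), `ϖ` a uniformizer (★ `IsUniformizingElement`), `ψ : AddChar F Circle` of conductor EXACTLY `𝒪` (`hψ : v x ≤ 1 → ψ x = 1`, `hψ' : ∃ x, v x ≤ |ϖ|⁻¹ ∧ ψ x ≠ 1`); characters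
are CIRCLE-valued (★ Tate ∕ `AddCharDuality` currency).  HONEST LABEL: HC_CM is proved only modulo the 7 printed citations (2 remaining named inputs: hLiu418 =
stmt-HodgeConjecture-24832, h413 = stmt-HodgeConjecture-24833) until rung 0 closes; count-neutral.

THE MATHEMATICS [BushnellHenniart2006, §1.7 Prop. (additive duality) and §1.1; Howe1977Kirillov, §1; HarishChandra1999, §17 Thm. 17.1 (the abelian case)].
* §1 RANK ONE, BY INDUCTION ON THE LEVEL: **every additive character `l` of `𝒪` trivial on `ϖ^e𝒪` is `y ↦ ψ(cy)` with `v(c) ≤ |ϖ|^{−e}`** (`exists_eq_map_mul_of_level`).  `e = 0`: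
  `c = 0`.  `e + 1`: `y ↦ l(ϖ^e y)` is trivial on `𝓂 = ϖ𝒪`, so by the residue-field step (★ `AddCharDuality.exists_apply_eq_apply_mul_of_maximalIdeal`, applied to the
  level-one character `ψ(ϖ⁻¹ ·)`) it is `y ↦ ψ(ϖ⁻¹c₁y)`, `c₁ ∈ 𝒪`; then `l · ψ(−ϖ^{−(e+1)}c₁ ·)` is trivial on `ϖ^e𝒪` and the induction hypothesis applies.
* §2 THE LAYER `K_{N'} ⧸ K_N` (`1 ≤ N' ≤ N ≤ 2N'`): for `χ : GL_n(F) → 𝕊` MULTIPLICATIVE on `K_{N'}` and TRIVIAL on `K_N`, `Y ↦ χ(1 + ϖ^{N'}Y)` is an additive character of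
  `M_n(𝒪)` (★ `mul_inv_mul_mem_congruenceGL_pow_two_mul`: `(1+ϖ^{N'}Y)(1+ϖ^{N'}Y') ≡ 1+ϖ^{N'}(Y+Y')` mod `K_{2N'} ⊆ K_N`), its coordinate restrictions along `E_{ij}` are trivial on
  `ϖ^{N−N'}𝒪`, §1 gives `c_{ij}`, and with `X_{ab} := ϖ^{−N'} c_{ba}`: **`χ(k) = ψ(tr(X(k−1)))` on `K_{N'}`, `v(X) ≤ |ϖ|^{−N}`** (`exists_valBound_and_forall_eq_map_trace`), via
  `Y = Σ E_{ij}Y_{ij}` (Mathlib `Matrix.matrix_eq_sum_single`).  Together with ★ (H-char) injectivity: `(K_{N'}⧸K_N)^∧ ≅ ϖ^{−N}M_n(𝒪) ⧸ ϖ^{−N'}M_n(𝒪)`.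

## References
* [BushnellHenniart2006] C. J. Bushnell, G. Henniart, *The Local Langlands Conjecture for GL(2)*, Grundlehren 335 (2006), §1.7 Proposition (additive duality), §1.1.
* [Howe1977Kirillov] R. Howe, *Kirillov theory for compact p-adic groups*, Pacific J. Math. 73 (1977), 365–381, §1.
* [HarishChandra1999] Harish-Chandra (DeBacker–Sally), *Admissible Invariant Distributions on Reductive p-adic Groups*, ULECT 16 (1999), §17.
-/

set_option autoImplicit false
-- the mandated namespace repeats `HodgeConjecture.HodgeConjecture`, as in every `Theorems/*.lean` of this sub-problem
set_option linter.dupNamespace false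

noncomputable section

open scoped MatrixGroups
open Matrix ValuativeRel Literature.NumberTheory.Automorphic

namespace Summit.HodgeConjecture.HodgeConjecture.Cruxes.H413.K2E3CongruenceLayerCharacterSurjectiveGL

variable {F : Type*} [Field F] [ValuativeRel F] [TopologicalSpace F] [IsNonarchimedeanLocalField F] {ϖ : F} {ψ : AddChar F Circle}

/-! ## §0 Small tools -/

omit [TopologicalSpace F] [IsNonarchimedeanLocalField F] in
/-- An additive character turns finite sums into finite products. [folklore] -/
theorem map_finset_sum_eq_prod {A M : Type*} [AddCommGroup A] [CommMonoid M] (φ : AddChar A M) {ι : Type*} (s : Finset ι) (f : ι → A) :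
    φ (∑ i ∈ s, f i) = ∏ i ∈ s, φ (f i) := by
  classical
  induction s using Finset.induction_on with
  | empty => rw [Finset.sum_empty, Finset.prod_empty, AddChar.map_zero_eq_one]
  | insert a s ha ih => rw [Finset.sum_insert ha, Finset.prod_insert ha, AddChar.map_add_eq_mul, ih]

omit [TopologicalSpace F] [IsNonarchimedeanLocalField F] in
/-- An element `y ∈ 𝒪` with `v(y) ≤ |ϖ|^e` is `ϖ^e z` with `z ∈ 𝒪` (`ϖ ≠ 0`). [folklore] -/
theorem exists_eq_pow_mul_of_valuation_le (hϖ0 : ϖ ≠ 0) (e : ℕ) {y : F} (hy : valuation F y ≤ valuation F ϖ ^ e) :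
    ∃ z : F, valuation F z ≤ 1 ∧ y = ϖ ^ e * z := by
  have hpow : ϖ ^ e ≠ 0 := pow_ne_zero _ hϖ0
  have hv : valuation F ϖ ^ e ≠ 0 := pow_ne_zero _ ((Valuation.ne_zero_iff _).2 hϖ0)
  refine ⟨(ϖ ^ e)⁻¹ * y, ?_, by rw [← mul_assoc, mul_inv_cancel₀ hpow, one_mul]⟩
  rw [map_mul, map_inv₀, map_pow]
  calc (valuation F ϖ ^ e)⁻¹ * valuation F y ≤ (valuation F ϖ ^ e)⁻¹ * valuation F ϖ ^ e := mul_le_mul_right hy _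
    _ = 1 := inv_mul_cancel₀ hv

/-- Elements of the maximal ideal `𝓂 ⊂ 𝒪` have valuation `≤ |ϖ|` (discreteness: `𝓂 = ϖ𝒪`, ★ `IsUniformizingElement.exists_eq_mul`). [cite: BushnellHenniart2006, §1.1] -/
theorem valuation_le_of_mem_maximalIdeal (hϖ : IsUniformizingElement ϖ) {y : 𝒪[F]} (hy : y ∈ 𝓂[F]) : valuation F (y : F) ≤ valuation F ϖ := by
  have hlt : valuation F (y : F) < 1 := by
    rw [IsLocalRing.mem_maximalIdeal, mem_nonunits_iff, (Valuation.integer.integers (valuation F)).isUnit_iff_valuation_eq_one] at hy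
    exact lt_of_le_of_ne ((Valuation.mem_integer_iff _ _).1 y.2) hy
  obtain ⟨z, hz, hyz⟩ := hϖ.exists_eq_mul y.2 hlt
  rw [hyz, map_mul]
  calc valuation F ϖ * valuation F z ≤ valuation F ϖ * 1 := mul_le_mul_right ((Valuation.mem_integer_iff _ _).1 hz) _
    _ = valuation F ϖ := mul_one _

/-! ## §1 Rank one: characters of `𝒪 ⧸ ϖ^e𝒪` are `y ↦ ψ(cy)`, `c ∈ ϖ^{−e}𝒪` -/

/-- **ADDITIVE DUALITY AT FINITE LEVEL**: for `ψ` of conductor exactly `𝒪` and every `e`, every additive character `l : 𝒪 → 𝕊` trivial on `ϖ^e𝒪 = {v ≤ |ϖ|^e}` is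
`y ↦ ψ(c·y)` for some `c` with `v(c) ≤ |ϖ|^{−e}` — by induction on `e` from the residue-field step ★ `AddCharDuality.exists_apply_eq_apply_mul_of_maximalIdeal`.
[cite: BushnellHenniart2006, §1.7 Proposition] [cite: HarishChandra1999, §17 Thm. 17.1] -/
theorem exists_eq_map_mul_of_level (hϖ : IsUniformizingElement ϖ) (hψ : ∀ x : F, valuation F x ≤ 1 → ψ x = 1)
    (hψ' : ∃ x : F, valuation F x ≤ (valuation F ϖ)⁻¹ ∧ ψ x ≠ 1) (e : ℕ) (l : AddChar 𝒪[F] Circle)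
    (hl : ∀ y : 𝒪[F], valuation F (y : F) ≤ valuation F ϖ ^ e → l y = 1) :
    ∃ c : F, valuation F c ≤ (valuation F ϖ ^ e)⁻¹ ∧ ∀ y : 𝒪[F], l y = ψ (c * y) := by
  induction e generalizing l with
  | zero =>
    refine ⟨0, by rw [map_zero]; exact zero_le, fun y => ?_⟩
    rw [zero_mul, AddChar.map_zero_eq_one]
    exact hl y (by rw [pow_zero]; exact (Valuation.mem_integer_iff _ _).1 y.2)
  | succ e ih =>
    have hϖ0 : ϖ ≠ 0 := hϖ.ne_zero
    have hvϖ0 : valuation F ϖ ≠ 0 := (Valuation.ne_zero_iff _).2 hϖ0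
    -- the level-one character `ψ₁ = ψ(ϖ⁻¹ ·)` and the hypotheses of the finite step
    have hψ1 : ∀ y : 𝒪[F], y ∈ 𝓂[F] → (ψ.mulShift ϖ⁻¹) y = 1 := fun y hy => by
      rw [AddChar.mulShift_apply]
      refine hψ _ ?_
      rw [map_mul, map_inv₀]
      calc (valuation F ϖ)⁻¹ * valuation F (y : F) ≤ (valuation F ϖ)⁻¹ * valuation F ϖ := mul_le_mul_right (valuation_le_of_mem_maximalIdeal hϖ hy) _
        _ = 1 := inv_mul_cancel₀ hvϖ0
    have hψ2 : ∃ y : 𝒪[F], (ψ.mulShift ϖ⁻¹) y ≠ 1 := by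
      obtain ⟨x, hx, hψx⟩ := hψ'
      have hmem : ϖ * x ∈ 𝒪[F] := by
        rw [Valuation.mem_integer_iff, map_mul]
        calc valuation F ϖ * valuation F x ≤ valuation F ϖ * (valuation F ϖ)⁻¹ := mul_le_mul_right hx _
          _ = 1 := mul_inv_cancel₀ hvϖ0
      refine ⟨⟨ϖ * x, hmem⟩, ?_⟩
      rwa [AddChar.mulShift_apply, Subtype.coe_mk, ← mul_assoc, inv_mul_cancel₀ hϖ0, one_mul]
    -- `l₁ y := l (ϖ^e y)` is trivial on `𝓂`
    let πe : 𝒪[F] := ⟨ϖ ^ e, hϖ.pow_mem e⟩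
    let l₁ : AddChar 𝒪[F] Circle := l.compAddMonoidHom (AddMonoidHom.mulLeft πe)
    have hl₁_apply : ∀ y : 𝒪[F], l₁ y = l (πe * y) := fun y => rfl
    have hl₁ : ∀ y ∈ 𝓂[F], l₁ y = 1 := fun y hy => by
      rw [hl₁_apply]
      refine hl _ ?_
      show valuation F (ϖ ^ e * (y : F)) ≤ _
      rw [map_mul, map_pow, pow_succ]
      exact mul_le_mul_right (valuation_le_of_mem_maximalIdeal hϖ hy) _
    obtain ⟨c₁, hc₁⟩ := AddCharDuality.exists_apply_eq_apply_mul_of_maximalIdeal hψ1 hψ2 l₁ hl₁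
    -- remove the top layer: `l' := l / ψ(c' ·)`, `c' = ϖ^{-(e+1)} c₁`
    set c' : F := (ϖ ^ (e + 1))⁻¹ * (c₁ : F) with hc'_def
    let l' : AddChar 𝒪[F] Circle := l / AddCharDuality.restrictInteger (ψ.mulShift c')
    have hl'_apply : ∀ y : 𝒪[F], l' y = l y / ψ (c' * y) := fun y => by
      rw [AddChar.div_apply', AddCharDuality.restrictInteger_apply, AddChar.mulShift_apply]
    have hl' : ∀ y : 𝒪[F], valuation F (y : F) ≤ valuation F ϖ ^ e → l' y = 1 := fun y hy => by
      obtain ⟨z, hz, hyz⟩ := exists_eq_pow_mul_of_valuation_le hϖ0 e hy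
      have hy' : y = πe * ⟨z, (Valuation.mem_integer_iff _ _).2 hz⟩ := Subtype.ext hyz
      have h1 : l y = ψ (ϖ⁻¹ * ((c₁ : F) * z)) := by
        rw [hy', ← hl₁_apply, hc₁, AddChar.mulShift_apply]
      have h2 : ψ (c' * y) = ψ (ϖ⁻¹ * ((c₁ : F) * z)) := by
        rw [hyz, hc'_def, pow_succ, mul_inv, show (ϖ ^ e)⁻¹ * ϖ⁻¹ * (c₁ : F) * (ϖ ^ e * z) = ϖ⁻¹ * ((c₁ : F) * z) * ((ϖ ^ e)⁻¹ * ϖ ^ e) by ring,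
          inv_mul_cancel₀ (pow_ne_zero _ hϖ0), mul_one]
      rw [hl'_apply, h1, h2, div_self']
    obtain ⟨c'', hc''v, hc''⟩ := ih l' hl'
    refine ⟨c'' + c', ?_, fun y => ?_⟩
    · -- `v(c'' + c') ≤ max ≤ |ϖ|^{-(e+1)}`
      have hpow : (valuation F ϖ ^ e)⁻¹ ≤ (valuation F ϖ ^ (e + 1))⁻¹ := by
        refine inv_anti₀ (pow_pos (zero_lt_iff.2 hvϖ0) _) ?_
        rw [pow_succ]
        exact mul_le_of_le_one_right' hϖ.valuation_le_one
      refine (Valuation.map_add _ _ _).trans (max_le (hc''v.trans hpow) ?_)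
      rw [hc'_def, map_mul, map_inv₀, map_pow]
      calc (valuation F ϖ ^ (e + 1))⁻¹ * valuation F (c₁ : F) ≤ (valuation F ϖ ^ (e + 1))⁻¹ * 1 :=
            mul_le_mul_right ((Valuation.mem_integer_iff _ _).1 c₁.2) _
        _ = (valuation F ϖ ^ (e + 1))⁻¹ := mul_one _
    · have h := hc'' y
      rw [hl'_apply, div_eq_iff_eq_mul] at h
      rw [h, ← AddChar.map_add_eq_mul, add_mul]

/-! ## §2 The congruence layer `K_{N'} ⧸ K_N` of `GL_n(F)` -/

variable {n : ℕ}

omit [TopologicalSpace F] [IsNonarchimedeanLocalField F] in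
/-- A matrix over `𝒪` pushed to `F` is an integral matrix. [folklore] -/
theorem isIntegralMatrix_map_coe (Y : Matrix (Fin n) (Fin n) 𝒪[F]) : IsIntegralMatrix (Y.map ((↑) : 𝒪[F] → F)) :=
  fun i j => (Y i j).2

/-- **EVERY CHARACTER OF THE LAYER `K_{N'} ⧸ K_N` IS A `χ_X`** (`1 ≤ N' ≤ N ≤ 2N'`, `ψ` of conductor exactly `𝒪`): for `χ : GL_n(F) → 𝕊` multiplicative on `K_{N'}` and
trivial on `K_N` there is `X` with `v(X) ≤ |ϖ|^{−N}` and `χ(k) = ψ(tr(X(k − 1)))` for all `k ∈ K_{N'}`.  (The values of `χ` off `K_{N'}` are never used; uniqueness of `X`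
modulo `ϖ^{−N'}M_n(𝒪)` is ★ (H-char) `forall_map_trace_eq_iff_valBound_sub`.) [cite: Howe1977Kirillov, §1] [cite: HarishChandra1999, §17 Thm. 17.1] [cite: BushnellHenniart2006, §1.7 Proposition] -/
theorem exists_valBound_and_forall_eq_map_trace (hϖ : IsUniformizingElement ϖ) (hψ : ∀ x : F, valuation F x ≤ 1 → ψ x = 1)
    (hψ' : ∃ x : F, valuation F x ≤ (valuation F ϖ)⁻¹ ∧ ψ x ≠ 1) {N' N : ℕ} (hN' : 1 ≤ N') (hle : N' ≤ N) (h2 : N ≤ 2 * N')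
    (χ : GL (Fin n) F → Circle)
    (hmul : ∀ k ∈ congruenceGL n (valuation F ϖ ^ N'), ∀ k' ∈ congruenceGL n (valuation F ϖ ^ N'), χ (k * k') = χ k * χ k')
    (htriv : ∀ k ∈ congruenceGL n (valuation F ϖ ^ N), χ k = 1) :
    ∃ X : Matrix (Fin n) (Fin n) F, ValBound (valuation F ϖ ^ N)⁻¹ X ∧
      ∀ k ∈ congruenceGL n (valuation F ϖ ^ N'), χ k = ψ (Matrix.trace (X * ((k : Matrix (Fin n) (Fin n) F) - 1))) := by
  classical
  have hϖ0 : ϖ ≠ 0 := hϖ.ne_zero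
  have hvϖ0 : valuation F ϖ ≠ 0 := (Valuation.ne_zero_iff _).2 hϖ0
  obtain ⟨e, rfl⟩ : ∃ e, N = N' + e := ⟨N - N', (Nat.add_sub_cancel' hle).symm⟩
  -- levels: `K_{N'+N'} ≤ K_{N'+e} ≤ K_{N'}`
  have hK2 : congruenceGL n (valuation F ϖ ^ (N' + N')) ≤ congruenceGL n (valuation F ϖ ^ (N' + e)) :=
    congruenceGL_mono (pow_le_pow_right_of_le_one' hϖ.valuation_le_one (by omega))
  have hK1 : congruenceGL n (valuation F ϖ ^ (N' + e)) ≤ congruenceGL n (valuation F ϖ ^ N') :=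
    congruenceGL_mono (pow_le_pow_right_of_le_one' hϖ.valuation_le_one (by omega))
  -- the layer representatives `g Y = 1 + ϖ^{N'} Y`
  let g : Matrix (Fin n) (Fin n) 𝒪[F] → GL (Fin n) F := fun Y =>
    Matrix.GeneralLinearGroup.mk'' (1 + ϖ ^ N' • Y.map ((↑) : 𝒪[F] → F)) (isUnit_det_one_add_smul hϖ hN' (isIntegralMatrix_map_coe Y))
  have hg_coe : ∀ Y, ((g Y : GL (Fin n) F) : Matrix (Fin n) (Fin n) F) = 1 + ϖ ^ N' • Y.map ((↑) : 𝒪[F] → F) := fun Y => rfl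
  have hg_mem : ∀ Y, g Y ∈ congruenceGL n (valuation F ϖ ^ N') := fun Y => mk''_one_add_smul_mem_congruenceGL hϖ hN' (isIntegralMatrix_map_coe Y)
  -- additivity modulo `K_{2N'}`
  have hadd : ∀ Y Y' : Matrix (Fin n) (Fin n) 𝒪[F], χ (g (Y + Y')) = χ (g Y) * χ (g Y') := fun Y Y' => by
    have hl : ((g (Y + Y') : GL (Fin n) F) : Matrix (Fin n) (Fin n) F) = 1 + ϖ ^ N' • (Y.map ((↑) : 𝒪[F] → F) + Y'.map ((↑) : 𝒪[F] → F)) := by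
      rw [hg_coe, Matrix.map_add ((↑) : 𝒪[F] → F) (fun _ _ => rfl)]
    have hc := K2E3CongruenceLayersGL.mul_inv_mul_mem_congruenceGL_pow_two_mul hϖ hN' (isIntegralMatrix_map_coe Y) (isIntegralMatrix_map_coe Y')
      (hg_coe Y) (hg_coe Y') hl
    have e1 : g (Y + Y') = (g Y * g Y') * ((g Y * g Y')⁻¹ * g (Y + Y')) := by group
    rw [e1, hmul _ (Subgroup.mul_mem _ (hg_mem Y) (hg_mem Y')) _ (hK1 (hK2 hc)), hmul _ (hg_mem Y) _ (hg_mem Y'), htriv _ (hK2 hc), mul_one]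
  have hzero : χ (g 0) = 1 := by
    have h1 : g 0 = 1 := Units.ext (by rw [hg_coe, Matrix.map_zero ((↑) : 𝒪[F] → F) rfl, smul_zero, add_zero, Units.val_one])
    rw [h1]
    exact htriv 1 (Subgroup.one_mem _)
  -- the layer character as an additive character of `M_n(𝒪)`
  let Λ : AddChar (Matrix (Fin n) (Fin n) 𝒪[F]) Circle := { toFun := fun Y => χ (g Y), map_zero_eq_one' := hzero, map_add_eq_mul' := hadd }
  have hΛ : ∀ Y, Λ Y = χ (g Y) := fun Y => rfl
  -- the coordinate characters and their level
  have hcoord : ∀ i j : Fin n, ∃ c : F, valuation F c ≤ (valuation F ϖ ^ e)⁻¹ ∧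
      ∀ y : 𝒪[F], Λ (Matrix.single i j y) = ψ (c * y) := fun i j => by
    refine exists_eq_map_mul_of_level hϖ hψ hψ' e (Λ.compAddMonoidHom (Matrix.singleAddMonoidHom i j)) fun y hy => ?_
    rw [AddChar.compAddMonoidHom_apply]
    change Λ (Matrix.single i j y) = 1
    rw [hΛ]
    refine htriv _ ((K2E3CongruenceLayersGL.mem_congruenceGL_iff_valBound_sub_one_of_mem_glInt (congruenceGL_le_glInt _ (hg_mem _)) _).2 ?_)
    rw [hg_coe, add_sub_cancel_left]
    intro a b
    rw [Matrix.smul_apply, Matrix.map_apply, smul_eq_mul, map_mul, map_pow, pow_add, Matrix.single_apply]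
    split_ifs
    · exact mul_le_mul_right hy _
    · rw [ZeroMemClass.coe_zero, map_zero, mul_zero]; exact zero_le
  choose c hcv hc using hcoord
  refine ⟨Matrix.of fun a b => (ϖ ^ N')⁻¹ * c b a, fun a b => ?_, fun k hk => ?_⟩
  · -- `v(X) ≤ |ϖ|^{-(N'+e)}`
    rw [Matrix.of_apply, map_mul, map_inv₀, map_pow, pow_add, mul_inv]
    exact mul_le_mul_right (hcv b a) _
  · -- `χ k = Λ Y = ∏ ψ(c_{ij} Y_{ij}) = ψ(Σ c_{ij} Y_{ij}) = ψ(tr(X(k-1)))`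
    obtain ⟨Y₀, hY₀, hkY₀⟩ := exists_eq_one_add_smul_of_mem_congruenceGL hϖ0 hk
    let Y : Matrix (Fin n) (Fin n) 𝒪[F] := Matrix.of fun a b => ⟨Y₀ a b, hY₀ a b⟩
    have hYmap : Y.map ((↑) : 𝒪[F] → F) = Y₀ := by ext a b; rfl
    have hkg : k = g Y := Units.ext (by rw [hkY₀, hg_coe, hYmap])
    have hsum : χ k = ψ (∑ a, ∑ b, c a b * (Y a b : F)) := by
      rw [hkg, ← hΛ]
      conv_lhs => rw [Matrix.matrix_eq_sum_single Y]
      rw [show Λ (∑ i, ∑ j, Matrix.single i j (Y i j)) = ∏ i, ∏ j, Λ (Matrix.single i j (Y i j)) by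
            rw [map_finset_sum_eq_prod]; exact Finset.prod_congr rfl fun i _ => map_finset_sum_eq_prod _ _ _,
        show ψ (∑ a, ∑ b, c a b * (Y a b : F)) = ∏ a, ∏ b, ψ (c a b * (Y a b : F)) by
            rw [map_finset_sum_eq_prod]; exact Finset.prod_congr rfl fun a _ => map_finset_sum_eq_prod _ _ _]
      exact Finset.prod_congr rfl fun i _ => Finset.prod_congr rfl fun j _ => hc i j (Y i j)
    rw [hsum, hkY₀, add_sub_cancel_left]
    refine congrArg ψ ?_
    symm
    rw [Matrix.mul_smul, Matrix.trace_smul, smul_eq_mul, Matrix.trace, Finset.mul_sum]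
    simp only [Matrix.diag_apply, Matrix.mul_apply, Matrix.of_apply, Finset.mul_sum]
    rw [Finset.sum_comm]
    refine Finset.sum_congr rfl fun a _ => Finset.sum_congr rfl fun b _ => ?_
    rw [← mul_assoc, ← mul_assoc, mul_inv_cancel₀ (pow_ne_zero _ hϖ0), one_mul]
    rfl

end Summit.HodgeConjecture.HodgeConjecture.Cruxes.H413.K2E3CongruenceLayerCharacterSurjectiveGL

end
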